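import Summits.Parity.GeneralizedHardyLittlewood.Theorems.PrimeLevelFamEdgeIdeaDeltasPeterssonLayersSplit
import Literature.Analysis.FunctionSpaces.BesselJAlternatingBound
import HarnessLib

/-!
# Route `PrimeLevelFamEdge`, crux K_A `MomentsBeyondDiagonal` (stmt-Parity-20007), line «petersson_layers» v4:
# SEPARATION OF VARIABLES in the layer kernel — the Bessel factor `J₁(4π√(ab)/(qr))` as a power series in `ab`

The layer-`r` kernel of deck 21a is `layerKernel q r a b = (2π/q) r⁻¹ S(a, b; qr) J₁(x)`, `x = 4π√(ab)/(qr)`.  In the far /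
band layers (`r > q̂^{ρ}`, `ρ > Δ'`, pairs with `n₁n₂ ≲ q̂^{2+η}`) the argument `x` is SMALL, and the Taylor series
`J₁(x) = Σ_k (−1)^k (x/2)^{2k+1}/(k!(k+1)!)` separates the variables: `(x/2)^{2k+1} = (2π/(qr))^{2k+1} (√a)^{2k+1} (√b)^{2k+1}`.
This file records, for the tree's `besselJ` / `besselJTerm` (Literature `BesselJ.lean`, `BesselJAlternatingBound.lean`):
* `layerKernel_of_ne_zero` — the kernel unfolded to `(2π/q)·(r⁻¹ S(a,b;qr) J₁(x))`;
* `besselJTerm_one_layer_eq` — the `k`-th Taylor term in SEPARATED closed form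
  `(−1)^k/(k!(k+1)!) · (2π/(qr))^{2k+1} · (√a)^{2k+1} · (√b)^{2k+1}`;
* `abs_besselJ_one_sub_sum_le_layer` — the Leibniz remainder `|J₁(x) − Σ_{k<K} …| ≤ (2π√(ab)/(qr))^{2K+1}/(K!(K+1)!)`
  whenever `2π²ab ≤ (qr)²` (i.e. `x² ≤ 8`, the alternating regime of `J₁`);
* `norm_layerKernel_sub_truncation_le` — hence `‖K-kernel(a,b) − (2π/q) r⁻¹ S(a,b;qr) Σ_{k<K} T_k(a,b)‖ ≤
  (2π/q) r⁻¹ ‖S(a,b;qr)‖ (2π√(ab)/(qr))^{2K+1}/(K!(K+1)!)`.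
With the Hecke reindexing (`…LayersHeckeReindex`), the product identity / unit swap (`…LayersKloostermanProduct`), the
gcd extraction (`…LayersKloostermanScale`) and the completion bound (`…LayersFourierBound`) this is the separation step that
turns a truncated Petersson layer into finitely many BILINEAR Kloosterman forms `Σ α_u β_v S(·,·;qr)` (print band of
`stub_farP`: Pascadi Thm 7.1 = Literature `pascadi2025_theorem71`; generic band `stub_band`).
Proof only (def-free helper); no layer is bounded here; K_A NOT proved; nothing about Landau–Siegel zeros.
-/

noncomputable section

open Finset
open scoped Real Nat
open Literature.NumberTheory.LFunctions
open Literature.Analysis.FunctionSpaces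

namespace Summit.Parity.GeneralizedHardyLittlewood.Theorems.MomentsBeyondDiagonal.Layers

open Summit.Parity.GeneralizedHardyLittlewood.Theorems.PrimeLevelFamEdgeIdeaDeltas.PeterssonLayers

/-! ## §1. The kernel unfolded -/

/-- The layer-`r` kernel (`r ≥ 1`) unfolded: `(2π/q) · (r⁻¹ · S(a, b; qr) · J₁(4π√(ab)/(qr)))`. [folklore] -/
theorem layerKernel_of_ne_zero (q : ℕ) [NeZero q] {r : ℕ} (hr : r ≠ 0) (a b : ℕ) :
    layerKernel q r a b =
      haveI : NeZero (q * r) := ⟨mul_ne_zero (NeZero.ne q) hr⟩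
      (2 * (π : ℂ) / (q : ℂ)) * ((r : ℂ)⁻¹ *
        kloostermanSum (q * r) (a : ZMod (q * r)) (b : ZMod (q * r)) *
        ((besselJ 1 (4 * π * Real.sqrt ((a : ℝ) * b) / ((q : ℝ) * r)) : ℝ) : ℂ)) := by
  unfold layerKernel
  rw [KowalskiMichel2000.petKloostermanTerm_of_ne_zero q a b hr]

/-! ## §2. The Taylor terms of `J₁` in the layer variables: separated closed form -/

/-- The Bessel argument halved: `x/2 = 2π√(ab)/(qr) = (2π/(qr)) · √a · √b`. [folklore] -/
theorem layer_arg_half_eq (q r a b : ℕ) :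
    4 * π * Real.sqrt ((a : ℝ) * b) / ((q : ℝ) * r) / 2 =
      (2 * π / ((q : ℝ) * r)) * Real.sqrt a * Real.sqrt b := by
  rw [Real.sqrt_mul (Nat.cast_nonneg a)]
  ring

/-- **The `k`-th Taylor term of `J₁(4π√(ab)/(qr))`, variables separated:**
`besselJTerm 1 x k = (−1)^k/(k!(k+1)!) · (2π/(qr))^{2k+1} · (√a)^{2k+1} · (√b)^{2k+1}`. [cite: DLMF, 10.2.2] -/
theorem besselJTerm_one_layer_eq (q r a b k : ℕ) :
    besselJTerm 1 (4 * π * Real.sqrt ((a : ℝ) * b) / ((q : ℝ) * r)) k =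
      (-1 : ℝ) ^ k / ((k ! : ℝ) * ((k + 1)! : ℝ)) *
        ((2 * π / ((q : ℝ) * r)) ^ (2 * k + 1) * Real.sqrt a ^ (2 * k + 1) * Real.sqrt b ^ (2 * k + 1)) := by
  unfold besselJTerm
  rw [layer_arg_half_eq, mul_pow, mul_pow]

/-- The truncated series in separated form: `Σ_{k<K} besselJTerm 1 x k = Σ_{k<K} c_k (2π/(qr))^{2k+1} (√a)^{2k+1} (√b)^{2k+1}`,
`c_k = (−1)^k/(k!(k+1)!)`. [cite: DLMF, 10.2.2] -/
theorem sum_besselJTerm_one_layer_eq (q r a b K : ℕ) :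
    ∑ k ∈ range K, besselJTerm 1 (4 * π * Real.sqrt ((a : ℝ) * b) / ((q : ℝ) * r)) k =
      ∑ k ∈ range K, (-1 : ℝ) ^ k / ((k ! : ℝ) * ((k + 1)! : ℝ)) *
        ((2 * π / ((q : ℝ) * r)) ^ (2 * k + 1) * Real.sqrt a ^ (2 * k + 1) * Real.sqrt b ^ (2 * k + 1)) :=
  sum_congr rfl fun k _ ↦ besselJTerm_one_layer_eq q r a b k

/-! ## §3. The Leibniz remainder in the layer variables -/

/-- In the regime `2π²·ab ≤ (qr)²` (equivalently `x² ≤ 8` for `x = 4π√(ab)/(qr)`; all far/band layers on the AFE-effective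
box), `J₁` is alternating with decreasing terms: `|J₁(x) − Σ_{k<K} besselJTerm 1 x k| ≤ (2π√(ab)/(qr))^{2K+1}/(K!(K+1)!)`.
[cite: DLMF, 10.2.2; Watson1944, §2.11] -/
theorem abs_besselJ_one_sub_sum_le_layer {q r : ℕ} (hq : 0 < q) (hr : 0 < r) (a b K : ℕ)
    (hab : 2 * π ^ 2 * ((a : ℝ) * b) ≤ ((q : ℝ) * r) ^ 2) :
    |besselJ 1 (4 * π * Real.sqrt ((a : ℝ) * b) / ((q : ℝ) * r)) -
        ∑ k ∈ range K, besselJTerm 1 (4 * π * Real.sqrt ((a : ℝ) * b) / ((q : ℝ) * r)) k| ≤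
      (2 * π * Real.sqrt ((a : ℝ) * b) / ((q : ℝ) * r)) ^ (2 * K + 1) / ((K ! : ℝ) * ((K + 1)! : ℝ)) := by
  set x : ℝ := 4 * π * Real.sqrt ((a : ℝ) * b) / ((q : ℝ) * r) with hx
  have hqr : (0 : ℝ) < (q : ℝ) * r := by positivity
  have hab0 : (0 : ℝ) ≤ (a : ℝ) * b := by positivity
  have hx2 : x ^ 2 ≤ 4 * ((1 : ℕ) + 1 : ℝ) := by
    rw [hx, div_pow, mul_pow, mul_pow, Real.sq_sqrt hab0, div_le_iff₀ (pow_pos hqr 2)]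
    norm_num
    nlinarith [hab, Real.pi_pos]
  have h := abs_besselJ_sub_sum_range_le_abs_besselJTerm_of_sq_le 1 hx2 K
  rw [abs_besselJTerm_eq] at h
  have hx0 : 0 ≤ x / 2 := by rw [hx]; positivity
  rw [abs_of_nonneg hx0, show x / 2 = 2 * π * Real.sqrt ((a : ℝ) * b) / ((q : ℝ) * r) by rw [hx]; ring] at h
  simpa using h

/-! ## §4. The kernel against its separated truncation -/

/-- **The layer kernel minus its `K`-term separated truncation** (`r ≥ 1`, `2π²ab ≤ (qr)²`):
`‖K-kernel(a,b) − (2π/q)·r⁻¹·S(a,b;qr)·Σ_{k<K} c_k (2π/(qr))^{2k+1}(√a)^{2k+1}(√b)^{2k+1}‖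
 ≤ (2π/q)·r⁻¹·‖S(a,b;qr)‖·(2π√(ab)/(qr))^{2K+1}/(K!(K+1)!)`. [cite: DLMF, 10.2.2; KowalskiMichel2000, §2.4.2 p. 312] -/
theorem norm_layerKernel_sub_truncation_le (q : ℕ) [NeZero q] {r : ℕ} (hr : 0 < r) (a b K : ℕ)
    (hab : 2 * π ^ 2 * ((a : ℝ) * b) ≤ ((q : ℝ) * r) ^ 2) :
    haveI : NeZero (q * r) := ⟨mul_ne_zero (NeZero.ne q) hr.ne'⟩
    ‖layerKernel q r a b -
        (2 * (π : ℂ) / (q : ℂ)) * ((r : ℂ)⁻¹ *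
          kloostermanSum (q * r) (a : ZMod (q * r)) (b : ZMod (q * r)) *
          ((∑ k ∈ range K, (-1 : ℝ) ^ k / ((k ! : ℝ) * ((k + 1)! : ℝ)) *
            ((2 * π / ((q : ℝ) * r)) ^ (2 * k + 1) * Real.sqrt a ^ (2 * k + 1) * Real.sqrt b ^ (2 * k + 1)) : ℝ) : ℂ))‖ ≤
      (2 * π / (q : ℝ)) * ((r : ℝ)⁻¹ * ‖kloostermanSum (q * r) (a : ZMod (q * r)) (b : ZMod (q * r))‖ *
        ((2 * π * Real.sqrt ((a : ℝ) * b) / ((q : ℝ) * r)) ^ (2 * K + 1) / ((K ! : ℝ) * ((K + 1)! : ℝ)))) := by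
  haveI : NeZero (q * r) := ⟨mul_ne_zero (NeZero.ne q) hr.ne'⟩
  have hq : 0 < q := Nat.pos_of_ne_zero (NeZero.ne q)
  rw [layerKernel_of_ne_zero q hr.ne' a b, ← sum_besselJTerm_one_layer_eq, ← mul_sub, ← mul_sub, ← Complex.ofReal_sub,
    norm_mul, norm_mul, Complex.norm_real, Real.norm_eq_abs]
  have h1 : ‖(2 * (π : ℂ) / (q : ℂ))‖ = 2 * π / (q : ℝ) := by
    rw [norm_div, Complex.norm_natCast]
    congr 1
    rw [Complex.norm_mul, Complex.norm_real, Real.norm_eq_abs, abs_of_pos Real.pi_pos, Complex.norm_two]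
  have h2 : ‖((r : ℂ)⁻¹ * kloostermanSum (q * r) (a : ZMod (q * r)) (b : ZMod (q * r)))‖ =
      (r : ℝ)⁻¹ * ‖kloostermanSum (q * r) (a : ZMod (q * r)) (b : ZMod (q * r))‖ := by
    rw [norm_mul, norm_inv, Complex.norm_natCast]
  rw [h1, h2]
  have hrem := abs_besselJ_one_sub_sum_le_layer hq hr a b K hab
  have hc : 0 ≤ 2 * π / (q : ℝ) := by positivity
  have hd : 0 ≤ (r : ℝ)⁻¹ * ‖kloostermanSum (q * r) (a : ZMod (q * r)) (b : ZMod (q * r))‖ := by positivity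
  exact mul_le_mul_of_nonneg_left (mul_le_mul_of_nonneg_left hrem hd) hc

end Summit.Parity.GeneralizedHardyLittlewood.Theorems.MomentsBeyondDiagonal.Layers

end
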